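import Literature.Geometry.Riemannian.RicciFlow
import Literature.Geometry.Riemannian.CurvatureDecomposition
import HarnessLib

/-!
# Hamilton's pinching estimates for the Ricci flow on PIC 4-manifolds (Hamilton 1997, §2; Chen–Zhu 2006, §2)
(topic `Geometry/Riemannian`)

Node RF3 ("curvature pinching", Hamilton 1997, Section B = §2) of the decomposition of
`Literature.Geometry.Riemannian.hamilton_chen_tang_zhu` (`HamiltonPIC.lean`; Hamilton 1997, Cor. 1.2(a)), over
`RicciFlow.lean` (`IsRicciFlow`) and `CurvatureDecomposition.lean` (the blocks `A, B, C` of the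
curvature in an orthonormal 4-frame). The estimates are phrased, as in the sources, through the
eigenvalues `a₁ ≤ a₂ ≤ a₃` of `A`, `c₁ ≤ c₂ ≤ c₃` of `C` and the singular values
`b₁ ≤ b₂ ≤ b₃` of `B`; here these enter only through the extremal ones, which are expressed
variationally (`a₁ = min uᵀAu`, `a₃ = max uᵀAu`, `b₃ = max uᵀBv` over unit vectors), so that
an inequality such as `a₃ ≤ Λ (a₁ + ρ)` becomes "`uᵀAu ≤ Λ (wᵀAw + ρ)` for all unit `u, w`".

## Contents

* `Matrix.PinchedBy A B C ρ Λ` — the pointwise content of (2.1)–(2.2) of Chen–Zhu 2006,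
  Lemma 2.1 (= Hamilton 1997, Thm. B1.1 without its last clause): `a₁ + ρ > 0`, `c₁ + ρ > 0`,
  `max{a₃, b₃, c₃} ≤ Λ (a₁ + ρ)` and `≤ Λ (c₁ + ρ)`, variationally (real definition).
* `Matrix.ImprovedPinchingAt A B C ρ Λ P t` — (2.3) of Chen–Zhu 2006, Lemma 2.1 (= Hamilton
  1997, Thm. B2.3): `b₃ ≤ (1 + Λ e^{Pt} / max{log √((a₁+ρ)(c₁+ρ)), 2}) √((a₁+ρ)(c₁+ρ))`,
  variationally (the right-hand side is increasing in `(a₁+ρ)(c₁+ρ)`, so taking all unit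
  `w, w'` in place of the minimisers is equivalent).
* `Matrix.RestrictedIsotropicPinching A B C Λ` — (2.4) of Chen–Zhu 2006: `a₃ ≤ Λ a₁`,
  `c₃ ≤ Λ c₁`, `b₃² ≤ a₁ c₁` (the condition satisfied by blow-up limits; real definition).
* NAMED FACT `hamilton_chenZhu_pinching` — **Chen–Zhu 2006, Lemma 2.1** ("Theorem B1.1 and
  Theorem B2.3 of [Ha7]"): for a compact 4-manifold with a PIC metric `g₀` there are
  `ρ, Λ, P > 0` depending only on `g₀` such that every Ricci flow of Riemannian metrics from
  `g₀` satisfies (2.1)–(2.3) at all points, times and orthonormal frames.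
* NAMED FACT `ricciFlow_preserves_twoSmallestEigenvaluesSum_ge` — **Hamilton 1997, §2.1,
  Thm. 1.2**, second sentence: "For any constant `m > 0` the Ricci flow preserves the
  inequalities `a₁ + a₂ ≥ m` and `c₁ + c₂ ≥ m`."

## Design notes

* The predicates `Matrix.PinchedBy`, `Matrix.ImprovedPinchingAt`,
  `Matrix.RestrictedIsotropicPinching` are deliberate dot-notation extensions of Mathlib's
  `Matrix` namespace (like `Matrix.TwoSmallestEigenvaluesSumGT` of `CurvatureDecomposition.lean`),
  so that they read `A.PinchedBy B C ρ Λ`-style on Hamilton's blocks.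
* Hamilton 1997 numbers its results by lettered chapter (A = §1, B = §2, …); the labels used in
  citations follow the printed/quoted form "Thm. B1.1", "Thm. B1.2", "Thm. B2.3", "Lemma A2.1"
  (as quoted by Chen–Zhu 2006), with the section/page of the held copy added.
* By `ricciFlow_uniqueness` (`RicciFlow.lean`) a Ricci flow of Riemannian metrics from `g₀` on a
  closed manifold is unique, so quantifying the pinching fact over *all* such flows is the
  sources' "the solution".

## References

* R. S. Hamilton, *Four-manifolds with positive isotropic curvature*, Comm. Anal. Geom. 5 (1997)
  1–92, Section B (§2): Thm. B1.1 (Pinching Theorem, §2.1 Thm. 1.1, p. 7), Thm. B1.2 (§2.1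
  Thm. 1.2, p. 7), Thm. B2.3 (§2.2, improving pinching). [Hamilton1997]
* B.-L. Chen, X.-P. Zhu, *Ricci flow with surgery on four-manifolds with positive isotropic
  curvature*, J. Differential Geom. 74 (2006) (arXiv:math/0504478), §2, Lemma 2.1 and
  (2.1)–(2.4) (p. 4). [ChenZhu2006]
-/

noncomputable section

open Bundle Set Matrix Real
open scoped Manifold ContDiff Topology

/-! ### Variational forms of the eigenvalue inequalities -/

namespace Matrix

variable (A B C : Matrix (Fin 3) (Fin 3) ℝ)

/-- **Pinching (2.1)–(2.2)** (Chen–Zhu 2006, Lemma 2.1; Hamilton 1997, Thm. B1.1) for the blocks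
`A, B, C` at one point, with constants `ρ, Λ`: `a₁ + ρ > 0`, `c₁ + ρ > 0`,
`max{a₃, b₃, c₃} ≤ Λ(a₁ + ρ)` and `max{a₃, b₃, c₃} ≤ Λ(c₁ + ρ)`, written variationally over
unit vectors of `ℝ³` (`a₁ = min_w wᵀAw`, `a₃ = max_u uᵀAu`, `b₃ = max_{u,v} uᵀBv`,
`c₁, c₃` likewise). [cite: ChenZhu2006, §2, Lemma 2.1, (2.1)–(2.2)] -/
def PinchedBy (ρ Λ : ℝ) : Prop :=
  (∀ w : Fin 3 → ℝ, w ⬝ᵥ w = 1 → 0 < w ⬝ᵥ (A *ᵥ w) + ρ ∧ 0 < w ⬝ᵥ (C *ᵥ w) + ρ) ∧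
  ∀ u v w : Fin 3 → ℝ, u ⬝ᵥ u = 1 → v ⬝ᵥ v = 1 → w ⬝ᵥ w = 1 →
    (u ⬝ᵥ (A *ᵥ u) ≤ Λ * (w ⬝ᵥ (A *ᵥ w) + ρ) ∧ u ⬝ᵥ (B *ᵥ v) ≤ Λ * (w ⬝ᵥ (A *ᵥ w) + ρ) ∧
      u ⬝ᵥ (C *ᵥ u) ≤ Λ * (w ⬝ᵥ (A *ᵥ w) + ρ)) ∧
    (u ⬝ᵥ (A *ᵥ u) ≤ Λ * (w ⬝ᵥ (C *ᵥ w) + ρ) ∧ u ⬝ᵥ (B *ᵥ v) ≤ Λ * (w ⬝ᵥ (C *ᵥ w) + ρ) ∧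
      u ⬝ᵥ (C *ᵥ u) ≤ Λ * (w ⬝ᵥ (C *ᵥ w) + ρ))

/-- **Improved pinching (2.3)** (Chen–Zhu 2006, Lemma 2.1; Hamilton 1997, Thm. B2.3) at time `t`
with constants `ρ, Λ, P`:
`b₃ ≤ (1 + Λ e^{Pt} / max{log √((a₁+ρ)(c₁+ρ)), 2}) · √((a₁+ρ)(c₁+ρ))`, i.e.
`b₃ / √((a₁+ρ)(c₁+ρ)) ≤ 1 + Λ e^{Pt} / max{log √((a₁+ρ)(c₁+ρ)), 2}`, written variationally: for
all unit `u, v` (for `b₃`) and all unit `w, w'` (in place of the minimisers defining `a₁`, `c₁`;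
legitimate because the right-hand side is an increasing function of `(a₁+ρ)(c₁+ρ)`).
[cite: ChenZhu2006, §2, Lemma 2.1, (2.3)] -/
def ImprovedPinchingAt (ρ Λ P t : ℝ) : Prop :=
  ∀ u v w w' : Fin 3 → ℝ, u ⬝ᵥ u = 1 → v ⬝ᵥ v = 1 → w ⬝ᵥ w = 1 → w' ⬝ᵥ w' = 1 →
    u ⬝ᵥ (B *ᵥ v) ≤
      (1 + Λ * exp (P * t) /
          max (log (sqrt ((w ⬝ᵥ (A *ᵥ w) + ρ) * (w' ⬝ᵥ (C *ᵥ w') + ρ)))) 2) *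
        sqrt ((w ⬝ᵥ (A *ᵥ w) + ρ) * (w' ⬝ᵥ (C *ᵥ w') + ρ))

/-- **Restricted isotropic curvature pinching (2.4)** (Chen–Zhu 2006, p. 4): `a₃ ≤ Λ a₁`,
`c₃ ≤ Λ c₁`, `b₃² ≤ a₁ c₁`, variationally; the condition satisfied by every rescaling limit of a
PIC Ricci flow along points of unbounded curvature, and part of the definition of an ancient
`κ`-solution with restricted isotropic curvature pinching (Chen–Zhu 2006, §3).
[cite: ChenZhu2006, §2, (2.4)] -/
def RestrictedIsotropicPinching (Λ : ℝ) : Prop :=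
  ∀ u v w w' : Fin 3 → ℝ, u ⬝ᵥ u = 1 → v ⬝ᵥ v = 1 → w ⬝ᵥ w = 1 → w' ⬝ᵥ w' = 1 →
    u ⬝ᵥ (A *ᵥ u) ≤ Λ * (w ⬝ᵥ (A *ᵥ w)) ∧ u ⬝ᵥ (C *ᵥ u) ≤ Λ * (w' ⬝ᵥ (C *ᵥ w')) ∧
      (u ⬝ᵥ (B *ᵥ v)) ^ 2 ≤ (w ⬝ᵥ (A *ᵥ w)) * (w' ⬝ᵥ (C *ᵥ w'))

variable {A B C}

/-- Pinching with constants `(ρ, Λ)` implies pinching with any larger `Λ' ≥ Λ` (the bounded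
quantities are compared with positive multiples of `a₁ + ρ > 0`, `c₁ + ρ > 0`). [folklore] -/
theorem PinchedBy.mono {ρ Λ Λ' : ℝ} (h : PinchedBy A B C ρ Λ) (hΛ : Λ ≤ Λ') :
    PinchedBy A B C ρ Λ' := by
  refine ⟨h.1, fun u v w hu hv hw ↦ ?_⟩
  obtain ⟨⟨h1, h2, h3⟩, ⟨h4, h5, h6⟩⟩ := h.2 u v w hu hv hw
  have hA : 0 < w ⬝ᵥ (A *ᵥ w) + ρ := (h.1 w hw).1
  have hC : 0 < w ⬝ᵥ (C *ᵥ w) + ρ := (h.1 w hw).2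
  have hmA : Λ * (w ⬝ᵥ (A *ᵥ w) + ρ) ≤ Λ' * (w ⬝ᵥ (A *ᵥ w) + ρ) :=
    mul_le_mul_of_nonneg_right hΛ hA.le
  have hmC : Λ * (w ⬝ᵥ (C *ᵥ w) + ρ) ≤ Λ' * (w ⬝ᵥ (C *ᵥ w) + ρ) :=
    mul_le_mul_of_nonneg_right hΛ hC.le
  exact ⟨⟨h1.trans hmA, h2.trans hmA, h3.trans hmA⟩, ⟨h4.trans hmC, h5.trans hmC, h6.trans hmC⟩⟩

/-- A consequence of restricted isotropic pinching used repeatedly: `(uᵀBv)² ≤ (uᵀAu)(uᵀCu)`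
for all unit `u, v` (the case `w = w' = u` of `b₃² ≤ a₁ c₁` in variational form).
[cite: ChenZhu2006, §2, (2.4)] -/
theorem RestrictedIsotropicPinching.sq_le {Λ : ℝ} (h : RestrictedIsotropicPinching A B C Λ)
    {u v : Fin 3 → ℝ} (hu : u ⬝ᵥ u = 1) (hv : v ⬝ᵥ v = 1) :
    (u ⬝ᵥ (B *ᵥ v)) ^ 2 ≤ (u ⬝ᵥ (A *ᵥ u)) * (u ⬝ᵥ (C *ᵥ u)) :=
  (h u v u u hu hv hu hu).2.2

end Matrix

/-! ### Named facts -/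

namespace Literature.Geometry.Riemannian

open Lorentzian

universe u

/-- NAMED FACT (**Chen–Zhu 2006, Lemma 2.1** = "Theorem B1.1 and Theorem B2.3 of [Ha7]",
arXiv p. 4: "Given an initial metric on a compact four-manifold with positive isotropic
curvature, there exist positive constants `ρ, Λ, P < +∞` depending only on the initial metric,
such that the solution to the Ricci flow satisfies `a₁ + ρ > 0` and `c₁ + ρ > 0` (2.1),
`max{a₃,b₃,c₃} ≤ Λ(a₁+ρ)` and `max{a₃,b₃,c₃} ≤ Λ(c₁+ρ)` (2.2), and
`b₃/√((a₁+ρ)(c₁+ρ)) ≤ 1 + Λ e^{Pt}/max{log √((a₁+ρ)(c₁+ρ)), 2}` (2.3) at all points and all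
times"; **Hamilton 1997, Thm. B1.1** (§2.1, Thm. 1.1, the Pinching Theorem, p. 7) and Thm. B2.3). Vended for
every Ricci flow of Riemannian metrics `(g, cov)` on `[0, T)` (`IsRicciFlow`) on a closed smooth
4-manifold whose initial metric `g 0` has positive isotropic curvature, the inequalities being
imposed on Hamilton's blocks `blockA/B/C (g t) (cov t) x e` in every `g t`-orthonormal frame `e`
at every point `x` and time `t ∈ [0, T)` (`Matrix.PinchedBy`, `Matrix.ImprovedPinchingAt`); the
constants depend only on `g 0`. Users take `(h : hamilton_chenZhu_pinching)`.
[cite: ChenZhu2006, §2, Lemma 2.1 ((2.1)–(2.3), p. 4)] [cite: Hamilton1997, Thm. B1.1 (§2.1, Thm. 1.1, p. 7) and Thm. B2.3] -/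
def hamilton_chenZhu_pinching : Prop :=
  ∀ (M : Type u) [TopologicalSpace M] [T2Space M] [SecondCountableTopology M] [CompactSpace M]
    [ChartedSpace (EuclideanSpace ℝ (Fin 4)) M] [IsManifold (𝓡 4) ∞ M]
    (g₀ : PseudoRiemannianMetric (𝓡 4) ∞ (EuclideanSpace ℝ (Fin 4))
      (TangentSpace (𝓡 4) : M → Type _)),
    g₀.IsRiemannian → g₀.HasPositiveIsotropicCurvature →
    ∃ ρ Λ P : ℝ, 0 < ρ ∧ 0 < Λ ∧ 0 < P ∧
      ∀ (T : ℝ)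
        (g : ℝ → PseudoRiemannianMetric (𝓡 4) ∞ (EuclideanSpace ℝ (Fin 4))
          (TangentSpace (𝓡 4) : M → Type _))
        (cov : ℝ → CovariantDerivative (𝓡 4) (EuclideanSpace ℝ (Fin 4))
          (TangentSpace (𝓡 4) : M → Type _)),
        IsRicciFlow g cov (Ico 0 T) → (∀ t ∈ Ico 0 T, (g t).IsRiemannian) → g 0 = g₀ →
        ∀ t ∈ Ico 0 T, ∀ (x : M) (e : Fin 4 → TangentSpace (𝓡 4) x),
          (g t).IsOrthonormalFrame x e →
            Matrix.PinchedBy ((g t).blockA (cov t) x e) ((g t).blockB (cov t) x e)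
                ((g t).blockC (cov t) x e) ρ Λ ∧
              Matrix.ImprovedPinchingAt ((g t).blockA (cov t) x e) ((g t).blockB (cov t) x e)
                ((g t).blockC (cov t) x e) ρ Λ P t

/-- NAMED FACT (**Hamilton 1997, Thm. B1.2** (§2.1, Thm. 1.2 of Section B), second sentence, p. 7: "For any constant
`m > 0` the Ricci flow preserves the inequalities `a₁ + a₂ ≥ m` and `c₁ + c₂ ≥ m`"; the first
sentence, preservation of PIC, is `ricciFlow_preserves_positiveIsotropicCurvature` in
`RicciFlow.lean`). Vended for Ricci flows of Riemannian metrics on `[0, T)` on a closed smooth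
4-manifold, frame-wise: if at `t = 0` every orthonormal frame has `a₁ + a₂ ≥ m` and
`c₁ + c₂ ≥ m` (`uᵀAu + vᵀAv ≥ m` for orthonormal `u, v ∈ ℝ³`, and the same for `C`), then so
does every `g t`, `t ∈ [0, T)`. Users take
`(h : ricciFlow_preserves_twoSmallestEigenvaluesSum_ge)`. [cite: Hamilton1997, Thm. B1.2 (§2.1, Thm. 1.2, p. 7)] -/
def ricciFlow_preserves_twoSmallestEigenvaluesSum_ge : Prop :=
  ∀ (M : Type u) [TopologicalSpace M] [T2Space M] [SecondCountableTopology M] [CompactSpace M]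
    [ChartedSpace (EuclideanSpace ℝ (Fin 4)) M] [IsManifold (𝓡 4) ∞ M] (T : ℝ)
    (g : ℝ → PseudoRiemannianMetric (𝓡 4) ∞ (EuclideanSpace ℝ (Fin 4))
      (TangentSpace (𝓡 4) : M → Type _))
    (cov : ℝ → CovariantDerivative (𝓡 4) (EuclideanSpace ℝ (Fin 4))
      (TangentSpace (𝓡 4) : M → Type _)),
    IsRicciFlow g cov (Ico 0 T) → (∀ t ∈ Ico 0 T, (g t).IsRiemannian) →
    ∀ m : ℝ, 0 < m →
      (∀ (x : M) (e : Fin 4 → TangentSpace (𝓡 4) x), (g 0).IsOrthonormalFrame x e →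
        ∀ u v : Fin 3 → ℝ, u ⬝ᵥ u = 1 → v ⬝ᵥ v = 1 → u ⬝ᵥ v = 0 →
          m ≤ u ⬝ᵥ ((g 0).blockA (cov 0) x e *ᵥ u) + v ⬝ᵥ ((g 0).blockA (cov 0) x e *ᵥ v) ∧
          m ≤ u ⬝ᵥ ((g 0).blockC (cov 0) x e *ᵥ u) + v ⬝ᵥ ((g 0).blockC (cov 0) x e *ᵥ v)) →
      ∀ t ∈ Ico 0 T, ∀ (x : M) (e : Fin 4 → TangentSpace (𝓡 4) x),
        (g t).IsOrthonormalFrame x e →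
        ∀ u v : Fin 3 → ℝ, u ⬝ᵥ u = 1 → v ⬝ᵥ v = 1 → u ⬝ᵥ v = 0 →
          m ≤ u ⬝ᵥ ((g t).blockA (cov t) x e *ᵥ u) + v ⬝ᵥ ((g t).blockA (cov t) x e *ᵥ v) ∧
          m ≤ u ⬝ᵥ ((g t).blockC (cov t) x e *ᵥ u) + v ⬝ᵥ ((g t).blockC (cov t) x e *ᵥ v)

end Literature.Geometry.Riemannian

end
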